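import Mathlib
import Literature.Analysis.FluidPDE.HardSphereCollisionRecord
import Literature.Analysis.FluidPDE.HardSpherePreCollisionSigma
import Literature.Analysis.FluidPDE.HardSphereWindowEnumeration
import Literature.MathematicalPhysics.KineticTheory.HardSphereEuler
import Literature.MathematicalPhysics.KineticTheory.HardSphereEulerProofs
import Literature.MathematicalPhysics.KineticTheory.CollisionTubePullbackFlight
import HarnessLib

/-!
# `OneFlightGossipEngine.OneFlightLayeredChaos` — kinematics at the later flight start
(crux stmt-AtomisticToContinuum-14535, line `Sketch`, lead cycle c3; disc-form reduction 2/4; registered stub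
`sepVec_laterFlightStart_eq`)

Part of the line's FLUX → DISC frame: the transverse offset at the later flight start is the tangential part of the
impact vector.  On `Φ.good` and on the window event, if every particle travels less than `1/8` during `(0, w]` (and
`ε < 1/4`), then with `t = t_n(i)`, `j` the `n`-th partner and `s⁺ = max(s_i, s_j)` the later flight start, both
partners fly freely from `s⁺` to `t` (`not_participates_of_mem_Ioo_flightStart`), the minimal image follows the pair
flight (`sepAt_orbit_eq`, `‖εω − (t − s⁺) g‖ < ε + 1/4 < 1/2`), so `sepVec(x_i(s⁺), x_j(s⁺)) = ε ω − (t − s⁺) g`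
with `g = v_i(s_i) − v_j(s_j)` the flight-start relative velocity read off the coarse past
(`sepAt_laterFlightStart_eq_aux`, `sepVec_laterFlightStart_eq`).
-/

open scoped BigOperators ENNReal
open MeasureTheory Set
open Literature.Analysis.FluidPDE Literature.MathematicalPhysics.KineticTheory

namespace Summit.AtomisticToContinuum.HydrodynamicLimit.Theorems.OLC

noncomputable section

/-- **The minimal image follows the last approach of the pair** (orbit vocabulary, times as variables). On `Φ.good`
and on the window event, if every particle travels less than `1/8` during `(0, w]` (and `ε < 1/4`), then with
`t = t_n(i)`, `j` the `n`-th partner and `s = max(s_i, s_j)` the later flight start: `s < t`, the velocities of `i`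
and `j` on `[s, t)` are their flight-start velocities, and `q(s) = q(t) − (t − s) (v_i(s) − v_j(s))` for the minimal-image
separation `q`, with `‖q(t)‖ = ε`. [folklore] -/
theorem sepAt_laterFlightStart_eq_aux {σ : ℝ} {N : ℕ} (hε4 : hsDiameter σ N < 4⁻¹)
    (Φ : HardSphereFlow (Torus.geometry (Fin 3)) (hsDiameter σ N) (N + 1))
    (i : Fin (N + 1)) (n : ℕ) (w : ℝ) {z : Config (N + 1) (Fin 3) T3} (hz : z ∈ Φ.good)
    (hW : n + 1 ≤ Set.ncard (collisionTimesOf (Torus.geometry (Fin 3)) (hsDiameter σ N) (fun t => Φ.flow t z) i ∩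
      Set.Ioc 0 w))
    (hshort : ∀ k : Fin (N + 1),
      ∫⁻ t in Set.Ioc 0 w, ENNReal.ofReal ‖(Φ.flow t z k).2‖ < ENNReal.ofReal 8⁻¹)
    {t : ℝ} (ht : Φ.nthCollisionTimeOf i n z = t) {j : Fin (N + 1)} (hj : Φ.nthPartnerOf i n z = j)
    {s : ℝ} (hs : max (flightStart (Torus.geometry (Fin 3)) (hsDiameter σ N) (orbit σ N Φ z) 0 i t)
      (flightStart (Torus.geometry (Fin 3)) (hsDiameter σ N) (orbit σ N Φ z) 0 j t) = s) :
    s < t ∧ ‖sepAt (orbit σ N Φ z t) i j‖ = hsDiameter σ N ∧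
      (∀ u ∈ Set.Ico s t, (orbit σ N Φ z u i).2 =
        (orbit σ N Φ z (flightStart (Torus.geometry (Fin 3)) (hsDiameter σ N) (orbit σ N Φ z) 0 i t) i).2) ∧
      (∀ u ∈ Set.Ico s t, (orbit σ N Φ z u j).2 =
        (orbit σ N Φ z (flightStart (Torus.geometry (Fin 3)) (hsDiameter σ N) (orbit σ N Φ z) 0 j t) j).2) ∧
      sepAt (orbit σ N Φ z s) i j = sepAt (orbit σ N Φ z t) i j - (t - s) • relVel (orbit σ N Φ z s) i j := by
  have hε2 : hsDiameter σ N < 2⁻¹ := hε4.trans (by norm_num)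
  -- the `n`-th collision is genuine: `0 < t ≤ w`, `(i, j)` is a contact pair
  have hn := Φ.le_encard_collisionTimesOf_of_le_ncard hW
  have htraj := Φ.isTrajectory z hz
  obtain ⟨hmem, -, -⟩ := htraj.nthCollisionTimeOf_enum_of_encard hn
  have hpart : Participates (Torus.geometry (Fin 3)) (hsDiameter σ N) (orbit σ N Φ z t) i := by
    have := (hmem n le_rfl).1
    rw [mem_collisionTimesOf] at this
    rw [← ht]
    exact this
  have ht0 : 0 < t := ht ▸ (hmem n le_rfl).2.1
  have htw : t ≤ w := ht ▸ (Φ.nthCollisionTimeOf_mem_window hz i hW).2.2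
  have hGreg := Torus.isHardSphereRegular_geometry (d := Fin 3) hε2
  have hpj : partner (Torus.geometry (Fin 3)) (hsDiameter σ N) (orbit σ N Φ z t) i = j := by
    rw [← hj, ← ht]; rfl
  have hp : (i, j) ∈ contactPairs (Torus.geometry (Fin 3)) (hsDiameter σ N) (orbit σ N Φ z t) := by
    rcases collide_partner hpart with h1 | h2
    · rw [hpj] at h1; exact h1
    · rw [hpj] at h2; exact (swap_mem_contactPairs_iff hGreg (p := (i, j))).1 h2
  have hcontact : ‖sepAt (orbit σ N Φ z t) i j‖ = hsDiameter σ N :=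
    (mem_contactSet.1 (mem_contactPairs.1 hp).2).2
  -- flight starts
  have hfi := htraj.finite_collisionTimesOf_inter_Ioo i 0 t
  have hfj := htraj.finite_collisionTimesOf_inter_Ioo j 0 t
  have hsi0 : 0 ≤ flightStart (Torus.geometry (Fin 3)) (hsDiameter σ N) (orbit σ N Φ z) 0 i t := le_flightStart hfi
  have hsit : flightStart (Torus.geometry (Fin 3)) (hsDiameter σ N) (orbit σ N Φ z) 0 i t < t := flightStart_lt hfi ht0
  have hsjt : flightStart (Torus.geometry (Fin 3)) (hsDiameter σ N) (orbit σ N Φ z) 0 j t < t := flightStart_lt hfj ht0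
  have hs0 : 0 ≤ s := hs ▸ le_max_of_le_left hsi0
  have hst : s < t := hs ▸ max_lt hsit hsjt
  have hsis : flightStart (Torus.geometry (Fin 3)) (hsDiameter σ N) (orbit σ N Φ z) 0 i t ≤ s := hs ▸ le_max_left _ _
  have hsjs : flightStart (Torus.geometry (Fin 3)) (hsDiameter σ N) (orbit σ N Φ z) 0 j t ≤ s := hs ▸ le_max_right _ _
  have hfree_i : ∀ u ∈ Ioo (flightStart (Torus.geometry (Fin 3)) (hsDiameter σ N) (orbit σ N Φ z) 0 i t) t,
      ¬ Participates (Torus.geometry (Fin 3)) (hsDiameter σ N) (orbit σ N Φ z u) i := fun u hu =>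
    htraj.not_participates_of_mem_Ioo_flightStart hu
  have hfree_j : ∀ u ∈ Ioo (flightStart (Torus.geometry (Fin 3)) (hsDiameter σ N) (orbit σ N Φ z) 0 j t) t,
      ¬ Participates (Torus.geometry (Fin 3)) (hsDiameter σ N) (orbit σ N Φ z u) j := fun u hu =>
    htraj.not_participates_of_mem_Ioo_flightStart hu
  have hfree_i' : ∀ u ∈ Ioo s t, ¬ Participates (Torus.geometry (Fin 3)) (hsDiameter σ N) (orbit σ N Φ z u) i :=
    fun u hu => hfree_i u ⟨hsis.trans_lt hu.1, hu.2⟩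
  have hfree_j' : ∀ u ∈ Ioo s t, ¬ Participates (Torus.geometry (Fin 3)) (hsDiameter σ N) (orbit σ N Φ z u) j :=
    fun u hu => hfree_j u ⟨hsjs.trans_lt hu.1, hu.2⟩
  -- velocities are the flight-start velocities on the flights
  have hvi : ∀ u ∈ Ico s t, (orbit σ N Φ z u i).2 =
      (orbit σ N Φ z (flightStart (Torus.geometry (Fin 3)) (hsDiameter σ N) (orbit σ N Φ z) 0 i t) i).2 :=
    fun u hu => orbit_vel_eq_of_forall_not_participates hz i hfree_i ⟨hsis.trans hu.1, hu.2⟩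
  have hvj : ∀ u ∈ Ico s t, (orbit σ N Φ z u j).2 =
      (orbit σ N Φ z (flightStart (Torus.geometry (Fin 3)) (hsDiameter σ N) (orbit σ N Φ z) 0 j t) j).2 :=
    fun u hu => orbit_vel_eq_of_forall_not_participates hz j hfree_j ⟨hsjs.trans hu.1, hu.2⟩
  -- path-length bound: `(t − s) ‖v_k(s)‖ < 1/8` for `k = i, j`
  have hpath : ∀ k : Fin (N + 1), (∀ u ∈ Ico s t, (orbit σ N Φ z u k).2 = (orbit σ N Φ z s k).2) →
      (t - s) * ‖(orbit σ N Φ z s k).2‖ < 8⁻¹ := by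
    intro k hk
    have hsub : Ioo s t ⊆ Ioc 0 w := fun u hu => ⟨hs0.trans_lt hu.1, hu.2.le.trans htw⟩
    have hcongr : ∫⁻ u in Ioo s t, ENNReal.ofReal ‖(Φ.flow u z k).2‖ =
        ∫⁻ _ in Ioo s t, ENNReal.ofReal ‖(orbit σ N Φ z s k).2‖ := by
      refine setLIntegral_congr_fun measurableSet_Ioo fun u hu => ?_
      change ENNReal.ofReal ‖(orbit σ N Φ z u k).2‖ = _
      rw [hk u ⟨hu.1.le, hu.2⟩]
    have hle : ENNReal.ofReal ((t - s) * ‖(orbit σ N Φ z s k).2‖) ≤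
        ∫⁻ u in Ioc 0 w, ENNReal.ofReal ‖(Φ.flow u z k).2‖ := by
      calc ENNReal.ofReal ((t - s) * ‖(orbit σ N Φ z s k).2‖)
          = ∫⁻ _ in Ioo s t, ENNReal.ofReal ‖(orbit σ N Φ z s k).2‖ := by
            rw [setLIntegral_const, Real.volume_Ioo, mul_comm, ENNReal.ofReal_mul (norm_nonneg _)]
        _ = ∫⁻ u in Ioo s t, ENNReal.ofReal ‖(Φ.flow u z k).2‖ := hcongr.symm
        _ ≤ _ := lintegral_mono_set hsub
    exact (ENNReal.ofReal_lt_ofReal_iff (by norm_num)).1 (hle.trans_lt (hshort k))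
  have hpi : (t - s) * ‖(orbit σ N Φ z s i).2‖ < 8⁻¹ :=
    hpath i fun u hu => by rw [hvi u hu, hvi s ⟨le_rfl, hst⟩]
  have hpj' : (t - s) * ‖(orbit σ N Φ z s j).2‖ < 8⁻¹ :=
    hpath j fun u hu => by rw [hvj u hu, hvj s ⟨le_rfl, hst⟩]
  have hrel_small : (t - s) * ‖relVel (orbit σ N Φ z s) i j‖ < 4⁻¹ := by
    have hts : 0 ≤ t - s := by linarith
    calc (t - s) * ‖relVel (orbit σ N Φ z s) i j‖
        ≤ (t - s) * (‖(orbit σ N Φ z s i).2‖ + ‖(orbit σ N Φ z s j).2‖) := by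
          gcongr; exact norm_sub_le _ _
      _ < 8⁻¹ + 8⁻¹ := by rw [mul_add]; exact add_lt_add hpi hpj'
      _ = 4⁻¹ := by norm_num
  -- the minimal image follows the pair flight from `t` back to `s`
  have hsmall : ‖sepAt (orbit σ N Φ z t) i j + (s - t) • relVel (orbit σ N Φ z s) i j‖ < 1 / 2 := by
    calc ‖sepAt (orbit σ N Φ z t) i j + (s - t) • relVel (orbit σ N Φ z s) i j‖
        ≤ ‖sepAt (orbit σ N Φ z t) i j‖ + ‖(s - t) • relVel (orbit σ N Φ z s) i j‖ := norm_add_le _ _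
      _ = hsDiameter σ N + (t - s) * ‖relVel (orbit σ N Φ z s) i j‖ := by
          rw [hcontact, norm_smul, Real.norm_eq_abs, abs_of_nonpos (by linarith), neg_sub]
      _ < 4⁻¹ + 4⁻¹ := add_lt_add hε4 hrel_small
      _ = 1 / 2 := by norm_num
  have hkey := sepAt_orbit_eq hz hst.le hfree_i' hfree_j' ⟨hst.le, le_rfl⟩ ⟨le_rfl, hst.le⟩ hsmall
  refine ⟨hst, hcontact, hvi, hvj, ?_⟩
  rw [hkey, ← neg_sub t s, neg_smul, ← sub_eq_add_neg]

/-- **The minimal image follows the last approach of the pair.** On `Φ.good` and on the window event, if every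
particle travels less than `1/8` during `(0, w]` (and `ε < 1/4`), then with `t = t_n(i)`, `j` the `n`-th partner,
`s⁺ = max(s_i, s_j)` the later flight start and `g = v_i(s_i) − v_j(s_j)` the flight-start relative velocity (read off the
coarse past, any cell map `q`): `sepVec (x_i(s⁺)) (x_j(s⁺)) = ε ω − (t − s⁺) g`, `ω` the impact vector of the `n`-th
record (registered stub `sepVec_laterFlightStart_eq` of crux stmt-AtomisticToContinuum-14535, line `Sketch`; the
kinematic input of the line's flux → disc frame). [folklore] -/
theorem sepVec_laterFlightStart_eq : ∀ {σ : ℝ} {N : ℕ}, 0 < Literature.MathematicalPhysics.KineticTheory.hsDiameter σ N → Literature.MathematicalPhysics.KineticTheory.hsDiameter σ N < 4⁻¹ → ∀ (Φ : Literature.Analysis.FluidPDE.HardSphereFlow (Literature.Analysis.FluidPDE.Torus.geometry (Fin 3)) (Literature.MathematicalPhysics.KineticTheory.hsDiameter σ N) (N + 1)) {C : Type*} (q : Literature.MathematicalPhysics.KineticTheory.T3 → C) (i : Fin (N + 1)) (n : ℕ) (w : ℝ) {z : Literature.Analysis.FluidPDE.Config (N + 1) (Fin 3) Literature.MathematicalPhysics.KineticTheory.T3},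 z ∈ Φ.good → n + 1 ≤ Set.ncard (Literature.Analysis.FluidPDE.collisionTimesOf (Literature.Analysis.FluidPDE.Torus.geometry (Fin 3)) (Literature.MathematicalPhysics.KineticTheory.hsDiameter σ N) (fun t => Φ.flow t z) i ∩ Set.Ioc 0 w) → (∀ k : Fin (N + 1), ∫⁻ t in Set.Ioc 0 w, ENNReal.ofReal ‖(Φ.flow t z k).2‖ < ENNReal.ofReal 8⁻¹) → (Literature.Analysis.FluidPDE.Torus.geometry (Fin 3)).sepVec (Φ.flow (max (Literature.Analysis.FluidPDE.flightStart (Literature.Analysis.FluidPDE.Torus.geometry (Fin 3)) (Literature.MathematicalPhysics.KineticTheory.hsDiameter σ N) (fun t => Φ.flow t z) 0 i (Φ.nthCollisionTimeOf i n z)) (Literature.Analysis.FluidPDE.flightStart (Literature.Analysis.FluidPDE.Torus.geometry (Fin 3)) (Literature.MathematicalPhysics.KineticTheory.hsDiameter σ N) (fun t => Φ.flow t z) 0 (Φ.nthPartnerOf i n z) (Φ.nthCollisionTimeOf i n z))) z i).1 (Φ.flow (max (Literature.Analysis.FluidPDE.flightStart (Literature.Analysis.FluidPDE.Torus.geometry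 (Fin 3)) (Literature.MathematicalPhysics.KineticTheory.hsDiameter σ N) (fun t => Φ.flow t z) 0 i (Φ.nthCollisionTimeOf i n z)) (Literature.Analysis.FluidPDE.flightStart (Literature.Analysis.FluidPDE.Torus.geometry (Fin 3)) (Literature.MathematicalPhysics.KineticTheory.hsDiameter σ N) (fun t => Φ.flow t z) 0 (Φ.nthPartnerOf i n z) (Φ.nthCollisionTimeOf i n z))) z (Φ.nthPartnerOf i n z)).1 = Literature.MathematicalPhysics.KineticTheory.hsDiameter σ N • (Φ.nthRecordOf i n z).impactVec - (Φ.nthCollisionTimeOf i n z - max (Literature.Analysis.FluidPDE.flightStart (Literature.Analysis.FluidPDE.Torus.geometry (Fin 3)) (Literature.MathematicalPhysics.KineticTheory.hsDiameter σ N) (fun t => Φ.flow t z) 0 i (Φ.nthCollisionTimeOf i n z)) (Literature.Analysis.FluidPDE.flightStart (Literature.Analysis.FluidPDE.Torus.geometry (Fin 3)) (Literature.MathematicalPhysics.KineticTheory.hsDiameter σ N) (fun t => Φ.flow t z) 0 (Φ.nthPartnerOf i n z) (Φ.nthCollisionTimeOf i n z))) • (((Φ.coarsePastOf q i n z).1 i).2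 - ((Φ.coarsePastOf q i n z).2 (Φ.nthPartnerOf i n z)).2) := by
  intro σ N hε hε4 Φ C q i n w z hz hW hshort
  obtain ⟨hst, -, hvi, hvj, hkey⟩ := sepAt_laterFlightStart_eq_aux hε4 Φ i n w hz hW hshort rfl rfl rfl
  have himp : hsDiameter σ N • (Φ.nthRecordOf i n z).impactVec =
      sepAt (orbit σ N Φ z (Φ.nthCollisionTimeOf i n z)) i (Φ.nthPartnerOf i n z) := by
    rw [HardSphereFlow.nthRecordOf, HardSphereCollisionRecord.ofConfig_impactVec, smul_smul,
      mul_inv_cancel₀ hε.ne', one_smul]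
    rfl
  have hgi : ((Φ.coarsePastOf q i n z).1 i).2 = (orbit σ N Φ z (flightStart (Torus.geometry (Fin 3))
      (hsDiameter σ N) (orbit σ N Φ z) 0 i (Φ.nthCollisionTimeOf i n z)) i).2 := by
    simp only [HardSphereFlow.coarsePastOf, coarseConfig_apply, orbit_apply]
    rfl
  have hgj : ((Φ.coarsePastOf q i n z).2 (Φ.nthPartnerOf i n z)).2 = (orbit σ N Φ z (flightStart
      (Torus.geometry (Fin 3)) (hsDiameter σ N) (orbit σ N Φ z) 0 (Φ.nthPartnerOf i n z) (Φ.nthCollisionTimeOf i n z))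
        (Φ.nthPartnerOf i n z)).2 := by
    simp only [HardSphereFlow.coarsePastOf, coarseConfig_apply, orbit_apply]
    rfl
  have hrel : ((Φ.coarsePastOf q i n z).1 i).2 - ((Φ.coarsePastOf q i n z).2 (Φ.nthPartnerOf i n z)).2 =
      relVel (orbit σ N Φ z (max (flightStart (Torus.geometry (Fin 3)) (hsDiameter σ N) (orbit σ N Φ z) 0 i
        (Φ.nthCollisionTimeOf i n z)) (flightStart (Torus.geometry (Fin 3)) (hsDiameter σ N) (orbit σ N Φ z) 0
        (Φ.nthPartnerOf i n z) (Φ.nthCollisionTimeOf i n z)))) i (Φ.nthPartnerOf i n z) := by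
    rw [relVel, hgi, hgj, hvi _ ⟨le_rfl, hst⟩, hvj _ ⟨le_rfl, hst⟩]
  rw [himp, hrel]
  exact hkey

end

end Summit.AtomisticToContinuum.HydrodynamicLimit.Theorems.OLC
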